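import Literature.NumberTheory.LFunctions.LiouvilleCertificate

/-!
# Certified Haselgrove computation, block 3: zeros 301–400

One compiled evaluation (`native_decide`) of
`Literature.NumberTheory.LFunctions.ZetaNumerics.Liouville.checkChunk 3`; see
`Literature/NumberTheory/LFunctions/LiouvilleCertificate.lean` for the checker, its soundness
theorem `checkChunk_sound'`, and the meaning of the data. In words: for each zero `j` of the block
(0-indexed `j = 300, …`), inside the certified bracket `[a_j, a_j + 1] · 2^{-240}` of
`MertensCertificateData.lean`, enclosures of `ζ(½+it₁)`, `ζ(½+it₂)` (for `ζ'(ρ)`), of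
`ζ(2ρ) = ζ(1 + 2iγ)` and of the summands `2 Re [k(γ) e^{iγy_L} ζ(2ρ)/(ρζ'(ρ))]`,
`2 Re [k(γ) e^{iγy_T} ζ(2ρ)/((ρ-1)ζ'(ρ))]` (`k(t) = g(t/1000)`, Jurkat–Peyerimhoff) are computed by
90-digit certified Euler–Maclaurin evaluations, summed, and compared with the claimed block bounds
`(L_3, U_3)`. The only non-standard axiom of this file is the `native_decide` auxiliary axiom of
`checkChunk_3` (trust in the Lean compiler, the `Lean.ofReduceBool` / `Lean.trustCompiler` family),
declared to the gate as `computational`.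
-/

namespace Literature.NumberTheory.LFunctions.LiouvilleCertificate.ZetaNumerics.Liouville

/-- Block 3 of the certified computation behind Haselgrove's `A*_{1000}(y) > 0`, `B*_{1000}(y) < 0`
[BorweinFergusonMossinghoff2008, §1 pp. 1683–1684]: `checkChunk 3 = true`.
[cite: BorweinFergusonMossinghoff2008, §1 pp. 1683–1684] -/
theorem checkChunk_3 : ZetaNumerics.Liouville.checkChunk 3 = true := by
  native_decide

end Literature.NumberTheory.LFunctions.LiouvilleCertificate.ZetaNumerics.Liouville
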